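import Literature.MathematicalPhysics.QuantumManyBody.CouplingPathSliceFloor
import HarnessLib

/-!
# Crux `CorrectorClosure` (stmt-AtomisticToContinuum-12058), line `llp-fidelity-arc` —
registered stub `stub_sliceFloor`

Supports (does not close) stmt-AtomisticToContinuum-12058, route `BECInsertionCorrector`.
The registered stub "slice floor" of the lead's skeleton
`Cruxes/CorrectorClosure/Lines/llp-fidelity-arc.lean`: the decoupled (`λ = 0`) coupled ground-state
energy dominates the `N`-body bath ground-state energy, a specialisation of the Literature theorem
`periodicGroundStateEnergy_le_coupledGroundStateEnergy_zero` (`CouplingPathSliceFloor.lean`).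
-/

noncomputable section

open MeasureTheory
open scoped ENNReal NNReal

namespace Summit.AtomisticToContinuum.BoseEinsteinCondensation.Theorems.CorrectorClosure.LlpFidelityArc

open Literature.MathematicalPhysics.QuantumManyBody.BoseGas

/-- **Registered stub of line `llp-fidelity-arc` — the slice floor.** For a repulsive finite-range
`v`, `N` bath particles and a torus of side `L > 0`, the decoupled tagged ground-state energy at
coupling `λ = 0` dominates the bath ground-state energy:
`periodicGroundStateEnergy v N L ≤ coupledGroundStateEnergy v 0 N L` (slice a tagged state at a
frozen impurity position, drop `|∇₀Ψ|²`, Tonelli; only the measurability of `v` is used).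
[folklore] -/
theorem stub_sliceFloor :
    ∀ (v : ℝ → ℝ≥0∞), IsRepulsiveFiniteRange v → ∀ (N : ℕ) (L : ℝ), 0 < L →
      periodicGroundStateEnergy v N L ≤ coupledGroundStateEnergy v 0 N L :=
  fun _ hv N L _ => periodicGroundStateEnergy_le_coupledGroundStateEnergy_zero hv.1 N L

end Summit.AtomisticToContinuum.BoseEinsteinCondensation.Theorems.CorrectorClosure.LlpFidelityArc

end
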